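import Mathlib.Algebra.BigOperators.Group.Finset.Basic
import Mathlib.Algebra.BigOperators.Ring.Finset
import Mathlib.Data.Fintype.BigOperators
import Mathlib.Data.Finset.Prod
import Mathlib.Tactic
import HarnessLib

/-!
# Venture HSemireg — the circulant (2, 5) design and its blow-ups: THEOREM L is attained on the ray `t = 5d/2`

Cell `pub-hsemireg`, widening group W5, seat w5-n7-1 (gen 12); files of record `widen/W5/N7-FEASIBILITY-w5n7.md`
(N7F) §3.9 (d) «MIN/MAX TABLE — ΣN(C₄) over ALL triangle-free flat designs on four coordinates … flat-2, u = 5: [90, 90]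
vs 80 (ONE design up to the lex reduction …); flat-4, u = 10: min 1440 vs 1280 (= 2⁴·90: the blow-up of the (2,5)
design attains it) … SCALING OBSERVATION (conjecture-grade): min ΣN(C₄)/d⁴ at x = u/d = 2.5 is 5.625 for BOTH d = 2
and d = 4 … Circulant sub-census … flat-2 u = 5: ΣN(C₄) ∈ {90}» and `widen/W5/FLATTF-w5n62g17.md` §0/§4 (THEOREM L:
`12 t d³ ≤ 2 ΣN(C₄) + 3 t² d²`, i.e. ΣN(C₄) ≥ (3/2) t d² (4d − t); «L is attained three times»); tree leg
`Summits/Ventures/HSemireg/FlatTriangleFreeFourCycles.lean` (`twelve_mul_le`), whose shapes are reused.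

THE PENTAGON DESIGN (a circulant (d, t) = (2, 5) design found by exhaustive search over ℤ/5-difference families at
this seat; 250 of the 10⁶ families are triangle-free, all with ΣN(C₄) = 90, matching N7F's circulant sub-census).
All four coordinates are `Fin 5`; `nAB = nAC = nAD = fun a => {a, a + 1}` (difference set {0, 1}) and
`nBC = nBD = nCD = fun b => {b + 2, b + 3}` (difference set {2, 3} = −{2, 3}, so these three maps are their own
transposes — the only transposes THEOREM L's hypotheses use). What is kernel-checked (`decide` on `Fin 5`, and the
product-finset bookkeeping of the g-fold blow-up written out for THIS design):

* `pent_degree`, `pent_transpose`, `pent_triangleFree` — flat (2, 5), triangle-free (both kinds of triples);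
* `pent_fourCycles` — each cyclic order carries 30 transversal 4-cycles (the three orders are one expression),
  ΣN(C₄) = 90; `pent_thmL_eq` — `12 t d³ = 2 ΣN(C₄) + 3 t² d²` at (2, 5) (480 = 180 + 300): THEOREM L is ATTAINED at
  `x = t/d = 5/2`, not only on the boundary `x = 2` (companion legs `FlatDesignBlowUp`, `FlatDesignTwiceMargin`);
* `pentBlowUp_flat`, `pentBlowUp_transpose`, `pentBlowUp_triangleFree`, `pentBlowUp_fourCycles`,
  `pentBlowUp_thmL_eq` — the g-fold blow-up on `Fin 5 × G` is a flat (2g, 5g) triangle-free design with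
  `30 g⁴` 4-cycles per cyclic order, ΣN(C₄) = 90 g⁴, and equality in THEOREM L: the bound is attained at EVERY
  `(d, t) = (2g, 5g)`. Consequently (with the tree's inequality) the minimum of ΣN(C₄) over flat triangle-free
  (2g, 5g) designs is exactly `90 g⁴ = 5.625 d⁴` — N7F §3.9 (d)'s SCALING OBSERVATION at x = 2.5, for every even d
  (that last sentence combines this file with `twelve_mul_le`; it is not restated as a theorem here).

HONEST FRAMING: finite combinatorics; nothing here is a statement about a variety, a sheaf or a Hodge class; the
identification with «flat K-secant coordinate skeleta» lives in N7F §3.6–§3.9. Nothing in this file says that HC,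
HC_CM or HC_AV holds; no door ∕ tier ∕ report sentence of the cell is a consequence of this file alone. This file
imports neither the tree leg of THEOREM L nor the companion legs (it restates no statement of theirs).
-/

namespace Summit.Ventures.HSemireg.FlatDesignPentagon

open Finset

section Pentagon

/-- The pentagon design is 2-regular: both kinds of maps have 2-element values. -/
theorem pent_degree : (∀ a : Fin 5, ({a, a + 1} : Finset (Fin 5)).card = 2) ∧
    ∀ b : Fin 5, ({b + 2, b + 3} : Finset (Fin 5)).card = 2 := by
  constructor <;> decide

/-- The maps `b ↦ {b + 2, b + 3}` (pairs `BC`, `BD`, `CD`) are their own transposes. (The maps `a ↦ {a, a + 1}` are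
not; their transposes `b ↦ {b, b + 4}` are not needed by THEOREM L's hypotheses.) -/
theorem pent_transpose : ∀ b c : Fin 5, c ∈ ({b + 2, b + 3} : Finset (Fin 5)) ↔ b ∈ ({c + 2, c + 3} : Finset (Fin 5)) := by
  decide

/-- The pentagon design is triangle-free: the triples `ABC, ABD, ACD` (shape: `{a, a+1}`, `{b+2, b+3}`, `{a, a+1}`)
and `BCD` (three times `{·+2, ·+3}`) carry no triangle. -/
theorem pent_triangleFree :
    (∀ a b c : Fin 5, b ∈ ({a, a + 1} : Finset (Fin 5)) → c ∈ ({b + 2, b + 3} : Finset (Fin 5)) →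
      c ∉ ({a, a + 1} : Finset (Fin 5))) ∧
    (∀ b c e : Fin 5, c ∈ ({b + 2, b + 3} : Finset (Fin 5)) → e ∈ ({c + 2, c + 3} : Finset (Fin 5)) →
      e ∉ ({b + 2, b + 3} : Finset (Fin 5))) := by
  constructor <;> decide

/-- Each cyclic order of the pentagon design carries exactly 30 transversal 4-cycles (the orders `(A B C D)`,
`(A B D C)`, `(A C B D)` of the tree leg are the same expression here), so ΣN(C₄) = 90. -/
theorem pent_fourCycles :
    (∑ a : Fin 5, ∑ b ∈ ({a, a + 1} : Finset (Fin 5)), ∑ e ∈ ({a, a + 1} : Finset (Fin 5)),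
        (({b + 2, b + 3} : Finset (Fin 5)) ∩ ({e + 2, e + 3} : Finset (Fin 5))).card) = 30 := by
  decide

/-- **THEOREM L is attained at (d, t) = (2, 5).** `12 · 5 · 2³ = 2 · (30 + 30 + 30) + 3 · 5² · 2²` (480 = 180 + 300),
with the three cyclic-order sums written exactly in the shape of `FlatTriangleFreeFourCycles.twelve_mul_le`. -/
theorem pent_thmL_eq :
    12 * 5 * 2 ^ 3 =
      2 * ((∑ a : Fin 5, ∑ b ∈ ({a, a + 1} : Finset (Fin 5)), ∑ e ∈ ({a, a + 1} : Finset (Fin 5)),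
              (({b + 2, b + 3} : Finset (Fin 5)) ∩ ({e + 2, e + 3} : Finset (Fin 5))).card)
          + (∑ a : Fin 5, ∑ b ∈ ({a, a + 1} : Finset (Fin 5)), ∑ c ∈ ({a, a + 1} : Finset (Fin 5)),
              (({b + 2, b + 3} : Finset (Fin 5)) ∩ ({c + 2, c + 3} : Finset (Fin 5))).card)
          + (∑ a : Fin 5, ∑ c ∈ ({a, a + 1} : Finset (Fin 5)), ∑ e ∈ ({a, a + 1} : Finset (Fin 5)),
              (({c + 2, c + 3} : Finset (Fin 5)) ∩ ({e + 2, e + 3} : Finset (Fin 5))).card))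
        + 3 * 5 ^ 2 * 2 ^ 2 := by
  rw [pent_fourCycles]
  norm_num

end Pentagon

section PentagonBlowUp

variable {G : Type*} [Fintype G]

/-- **The g-fold blow-up of the pentagon is a flat (2g, 5g) design**: `5 g` levels per coordinate, every level of
degree `2 g` for both kinds of maps. -/
theorem pentBlowUp_flat :
    Fintype.card (Fin 5 × G) = 5 * Fintype.card G ∧
    (∀ p : Fin 5 × G, (({p.1, p.1 + 1} : Finset (Fin 5)) ×ˢ (univ : Finset G)).card = 2 * Fintype.card G) ∧
    ∀ p : Fin 5 × G, (({p.1 + 2, p.1 + 3} : Finset (Fin 5)) ×ˢ (univ : Finset G)).card = 2 * Fintype.card G := by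
  refine ⟨by rw [Fintype.card_prod, Fintype.card_fin], fun p => ?_, fun p => ?_⟩
  · rw [card_product, pent_degree.1 p.1, card_univ]
  · rw [card_product, pent_degree.2 p.1, card_univ]

/-- The blown-up maps `p ↦ {p.1 + 2, p.1 + 3} ×ˢ univ` are their own transposes. -/
theorem pentBlowUp_transpose : ∀ p q : Fin 5 × G,
    q ∈ ({p.1 + 2, p.1 + 3} : Finset (Fin 5)) ×ˢ (univ : Finset G) ↔
      p ∈ ({q.1 + 2, q.1 + 3} : Finset (Fin 5)) ×ˢ (univ : Finset G) := by
  intro p q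
  simp only [mem_product, mem_univ, and_true]
  exact pent_transpose p.1 q.1

/-- **The blown-up pentagon is triangle-free** (both kinds of triples): a triangle would project to one of the
pentagon design. -/
theorem pentBlowUp_triangleFree :
    (∀ p q r : Fin 5 × G, q ∈ ({p.1, p.1 + 1} : Finset (Fin 5)) ×ˢ (univ : Finset G) →
      r ∈ ({q.1 + 2, q.1 + 3} : Finset (Fin 5)) ×ˢ (univ : Finset G) →
        r ∉ ({p.1, p.1 + 1} : Finset (Fin 5)) ×ˢ (univ : Finset G)) ∧
    ∀ p q r : Fin 5 × G, q ∈ ({p.1 + 2, p.1 + 3} : Finset (Fin 5)) ×ˢ (univ : Finset G) →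
      r ∈ ({q.1 + 2, q.1 + 3} : Finset (Fin 5)) ×ˢ (univ : Finset G) →
        r ∉ ({p.1 + 2, p.1 + 3} : Finset (Fin 5)) ×ˢ (univ : Finset G) := by
  constructor
  · intro p q r hq hr hr'
    simp only [mem_product, mem_univ, and_true] at hq hr hr'
    exact pent_triangleFree.1 _ _ _ hq hr hr'
  · intro p q r hq hr hr'
    simp only [mem_product, mem_univ, and_true] at hq hr hr'
    exact pent_triangleFree.2 _ _ _ hq hr hr'

variable [DecidableEq G]

/-- **The blown-up pentagon has `30 g⁴` transversal 4-cycles in each cyclic order** (ΣN(C₄) = 90 g⁴): one factor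
`g` for the copies of each of the four levels of a 4-cycle of the pentagon design. -/
theorem pentBlowUp_fourCycles :
    (∑ p : Fin 5 × G, ∑ q ∈ ({p.1, p.1 + 1} : Finset (Fin 5)) ×ˢ (univ : Finset G),
        ∑ s ∈ ({p.1, p.1 + 1} : Finset (Fin 5)) ×ˢ (univ : Finset G),
          ((({q.1 + 2, q.1 + 3} : Finset (Fin 5)) ×ˢ (univ : Finset G)) ∩
            (({s.1 + 2, s.1 + 3} : Finset (Fin 5)) ×ˢ (univ : Finset G))).card) = 30 * Fintype.card G ^ 4 := by
  have hinter : ∀ (b e : Fin 5), (({b + 2, b + 3} : Finset (Fin 5)) ×ˢ (univ : Finset G)) ∩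
      (({e + 2, e + 3} : Finset (Fin 5)) ×ˢ (univ : Finset G))
        = (({b + 2, b + 3} : Finset (Fin 5)) ∩ {e + 2, e + 3}) ×ˢ (univ : Finset G) := by
    intro b e
    rw [product_inter_product, inter_self]
  have key : (∑ p : Fin 5 × G, ∑ q ∈ ({p.1, p.1 + 1} : Finset (Fin 5)) ×ˢ (univ : Finset G),
      ∑ s ∈ ({p.1, p.1 + 1} : Finset (Fin 5)) ×ˢ (univ : Finset G),
        ((({q.1 + 2, q.1 + 3} : Finset (Fin 5)) ×ˢ (univ : Finset G)) ∩
          (({s.1 + 2, s.1 + 3} : Finset (Fin 5)) ×ˢ (univ : Finset G))).card)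
      = Fintype.card G ^ 4 * ∑ a : Fin 5, ∑ b ∈ ({a, a + 1} : Finset (Fin 5)),
          ∑ e ∈ ({a, a + 1} : Finset (Fin 5)),
            (({b + 2, b + 3} : Finset (Fin 5)) ∩ ({e + 2, e + 3} : Finset (Fin 5))).card := by
    simp_rw [hinter, card_product, card_univ]
    simp_rw [sum_product, sum_const, card_univ, smul_eq_mul]
    rw [Fintype.sum_prod_type]
    simp_rw [sum_const, card_univ, smul_eq_mul]
    simp_rw [mul_sum]
    refine sum_congr rfl fun a _ => sum_congr rfl fun b _ => sum_congr rfl fun e _ => ?_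
    ring
  rw [key, pent_fourCycles, mul_comm]

/-- **THEOREM L is attained at every (d, t) = (2g, 5g).** With `d = 2g`, `t = 5g` and the three (equal) cyclic-order
sums of the blown-up pentagon: `12 t d³ = 2 (N₁ + N₂ + N₃) + 3 t² d²` (both sides `480 g⁴`). Together with the tree's
`twelve_mul_le` the minimum of ΣN(C₄) over flat triangle-free (2g, 5g) designs is therefore exactly `90 g⁴`. -/
theorem pentBlowUp_thmL_eq :
    12 * (5 * Fintype.card G) * (2 * Fintype.card G) ^ 3 =
      2 * ((∑ p : Fin 5 × G, ∑ q ∈ ({p.1, p.1 + 1} : Finset (Fin 5)) ×ˢ (univ : Finset G),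
              ∑ s ∈ ({p.1, p.1 + 1} : Finset (Fin 5)) ×ˢ (univ : Finset G),
                ((({q.1 + 2, q.1 + 3} : Finset (Fin 5)) ×ˢ (univ : Finset G)) ∩
                  (({s.1 + 2, s.1 + 3} : Finset (Fin 5)) ×ˢ (univ : Finset G))).card)
          + (∑ p : Fin 5 × G, ∑ q ∈ ({p.1, p.1 + 1} : Finset (Fin 5)) ×ˢ (univ : Finset G),
              ∑ r ∈ ({p.1, p.1 + 1} : Finset (Fin 5)) ×ˢ (univ : Finset G),
                ((({q.1 + 2, q.1 + 3} : Finset (Fin 5)) ×ˢ (univ : Finset G)) ∩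
                  (({r.1 + 2, r.1 + 3} : Finset (Fin 5)) ×ˢ (univ : Finset G))).card)
          + (∑ p : Fin 5 × G, ∑ r ∈ ({p.1, p.1 + 1} : Finset (Fin 5)) ×ˢ (univ : Finset G),
              ∑ s ∈ ({p.1, p.1 + 1} : Finset (Fin 5)) ×ˢ (univ : Finset G),
                ((({r.1 + 2, r.1 + 3} : Finset (Fin 5)) ×ˢ (univ : Finset G)) ∩
                  (({s.1 + 2, s.1 + 3} : Finset (Fin 5)) ×ˢ (univ : Finset G))).card))
        + 3 * (5 * Fintype.card G) ^ 2 * (2 * Fintype.card G) ^ 2 := by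
  rw [pentBlowUp_fourCycles]
  ring

end PentagonBlowUp

end Summit.Ventures.HSemireg.FlatDesignPentagon
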